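import Literature.Geometry.Lorentzian.KerrStarChartBounds
import Literature.Geometry.Lorentzian.KerrSeparatedPotentialBounds
import Mathlib.Analysis.Calculus.Deriv.Inverse
import Mathlib.Analysis.SpecialFunctions.ExpDeriv
import HarnessLib

/-!
# Tortoise radius functions `r = R(r*)` on sub-extremal Kerr
# (Dafermos–Rodnianski–Shlapentokh-Rothman, §2.1.2)

(family `gr`, infrastructure for statement **gr.S24**; namespace `Literature.Geometry.Lorentzian.Kerr`)

Dafermos–Rodnianski–Shlapentokh-Rothman (*Decay for solutions of the wave equation on Kerr
exterior spacetimes III*, arXiv:1402.7034 = Ann. of Math. 183 (2016), §2.1.2) rescale the radius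
by the tortoise coordinate `r*`, `dr*/dr = (r² + a²)/Δ`, `r*(3M) = 0`, noting that "the
coordinate range `r > r₊` corresponds to the range `r* > −∞`", and thereafter "express functions
appearing in most estimates as functions of `r`" while differentiating in `r*` (`' = d/dr*`,
§5.2.3). The frequency analysis of their §§7–8 (`KerrSeparatedCurrents.lean`,
`KerrTimeDominatedCurrent.lean`) lives on `r* ∈ ℝ`; to pull the potential `V(r)` back to it one
needs the inverse function `r = R(r*)`.

This file introduces the predicate `IsTortoiseRadius M a R` — `R : ℝ → (r₊, ∞)` with
`dR/dx = Δ(R)/(R² + a²)`, `R → r₊` at `−∞`, `R → ∞` at `+∞` (i.e. `x = r*(R(x)) + const`; the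
additive normalisation of `r*` is immaterial for the estimates) — with its basic API (positivity,
strict monotonicity), and **proves that tortoise radius functions exist** for every `|a| < M`
(`exists_isTortoiseRadius`), by inverting the strictly increasing bijection
`s ↦ t̄(r₊ + eˢ) : ℝ → ℝ`, where `t̄ = starTime M a` is the explicit logarithmic primitive of
`(r² + a²)/Δ` of `KerrStarChartBounds.lean` (`= r*` up to a constant), and setting
`R = r₊ + exp ∘ (inverse)`.

## References

* M. Dafermos, I. Rodnianski, Y. Shlapentokh-Rothman, arXiv:1402.7034 = Ann. of Math. 183
  (2016), §2.1.2, display (rstar) (key `DafermosRodnianskiShlapentokhrothman2014`).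
-/

noncomputable section

open Filter Topology Set

namespace Literature.Geometry.Lorentzian

namespace Kerr

/-! ### The predicate -/

/-- **Tortoise radius function.** `R : ℝ → ℝ` is the Boyer–Lindquist/Kerr-star radius `r` read
as a function of a tortoise coordinate `x = r* + const` of `g_{M,a}`: `dR/dx = Δ(R)/(R² + a²)`
(the inverse of `dr*/dr = (r² + a²)/Δ`), with values in `(r₊, ∞)`, `R → r₊` as `x → −∞` and
`R → ∞` as `x → +∞` ("the coordinate range `r > r₊` corresponds to the range `r* > −∞`"). DRSR
arXiv:1402.7034, §2.1.2, (rstar). [cite: DafermosRodnianskiShlapentokhrothman2014, §2.1.2] -/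
structure IsTortoiseRadius (M a : ℝ) (R : ℝ → ℝ) : Prop where
  hasDerivAt : ∀ x, HasDerivAt R (delta M a (R x) / (R x ^ 2 + a ^ 2)) x
  rPlus_lt : ∀ x, rPlus M a < R x
  tendsto_atBot : Tendsto R atBot (𝓝 (rPlus M a))
  tendsto_atTop : Tendsto R atTop atTop

namespace IsTortoiseRadius

variable {M a : ℝ} {R : ℝ → ℝ}

/-- A tortoise radius function is continuous. [folklore] -/
theorem continuous (hR : IsTortoiseRadius M a R) : Continuous R :=
  continuous_iff_continuousAt.2 fun x ↦ (hR.hasDerivAt x).continuousAt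

/-- `R > 0` (as `R > r₊ ≥ M > 0` for `|a| < M`). [folklore] -/
theorem pos (hR : IsTortoiseRadius M a R) (hMa : IsSubextremal M a) (x : ℝ) : 0 < R x :=
  (hMa.pos.trans_le (M_le_rPlus M a)).trans (hR.rPlus_lt x)

/-- `R² + a² > 0`. [folklore] -/
theorem sq_add_sq_pos (hR : IsTortoiseRadius M a R) (hMa : IsSubextremal M a) (x : ℝ) :
    0 < R x ^ 2 + a ^ 2 := by
  have := hR.pos hMa x
  positivity

/-- `Δ(R) > 0`. [folklore] -/
theorem delta_pos (hR : IsTortoiseRadius M a R) (hMa : IsSubextremal M a) (x : ℝ) :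
    0 < delta M a (R x) :=
  Kerr.delta_pos (le_of_lt hMa) (hR.rPlus_lt x)

/-- `dR/dx > 0`. [folklore] -/
theorem deriv_pos (hR : IsTortoiseRadius M a R) (hMa : IsSubextremal M a) (x : ℝ) :
    0 < delta M a (R x) / (R x ^ 2 + a ^ 2) :=
  div_pos (hR.delta_pos hMa x) (hR.sq_add_sq_pos hMa x)

/-- A tortoise radius function is strictly increasing. [folklore] -/
theorem strictMono (hR : IsTortoiseRadius M a R) (hMa : IsSubextremal M a) : StrictMono R :=
  strictMono_of_deriv_pos fun x ↦ by rw [(hR.hasDerivAt x).deriv]; exact hR.deriv_pos hMa x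

/-- Eventually (as `x → +∞`) `R ≥ c`. [folklore] -/
theorem eventually_le (hR : IsTortoiseRadius M a R) (c : ℝ) : ∀ᶠ x in atTop, c ≤ R x :=
  hR.tendsto_atTop.eventually (eventually_ge_atTop c)

/-- `r*`-translates of a tortoise radius function are tortoise radius functions (the additive
normalisation of `r*`, e.g. `r*(3M) = 0` in DRSR, is free). [cite: DafermosRodnianskiShlapentokhrothman2014, §2.1.2] -/
theorem comp_add_const (hR : IsTortoiseRadius M a R) (c : ℝ) :
    IsTortoiseRadius M a (fun x ↦ R (x + c)) where
  hasDerivAt x := (hR.hasDerivAt (x + c)).comp_add_const x c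
  rPlus_lt x := hR.rPlus_lt (x + c)
  tendsto_atBot := hR.tendsto_atBot.comp (tendsto_atBot_add_const_right _ c tendsto_id)
  tendsto_atTop := hR.tendsto_atTop.comp (tendsto_atTop_add_const_right _ c tendsto_id)

end IsTortoiseRadius

/-! ### Existence: inverting `s ↦ t̄(r₊ + eˢ)` -/

section Existence

variable {M a : ℝ}

/-- The auxiliary bijection `g(s) = t̄(r₊ + eˢ)` (`t̄ = starTime M a`, a primitive of `(r² + a²)/Δ`
on `(r₊, ∞)`). [folklore] -/
def tortoiseAux (M a s : ℝ) : ℝ := starTime M a (rPlus M a + Real.exp s)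

/-- `dg/ds = ((ρ² + a²)/Δ(ρ)) eˢ`, `ρ = r₊ + eˢ`. [folklore] -/
theorem hasDerivAt_tortoiseAux (hMa : IsSubextremal M a) (s : ℝ) :
    HasDerivAt (tortoiseAux M a)
      (((rPlus M a + Real.exp s) ^ 2 + a ^ 2) / delta M a (rPlus M a + Real.exp s) * Real.exp s)
      s := by
  have hρ : rPlus M a < rPlus M a + Real.exp s := lt_add_of_pos_right _ (Real.exp_pos s)
  have h := (hasDerivAt_starTime hMa hρ).comp s ((Real.hasDerivAt_exp s).const_add (rPlus M a))
  exact h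

/-- `dg/ds > 0`. [folklore] -/
theorem tortoiseAux_deriv_pos (hMa : IsSubextremal M a) (s : ℝ) :
    0 < ((rPlus M a + Real.exp s) ^ 2 + a ^ 2) / delta M a (rPlus M a + Real.exp s) *
      Real.exp s := by
  have hρ : rPlus M a < rPlus M a + Real.exp s := lt_add_of_pos_right _ (Real.exp_pos s)
  have h0 : 0 < rPlus M a + Real.exp s := (hMa.pos.trans_le (M_le_rPlus M a)).trans hρ
  exact mul_pos (div_pos (by positivity) (Kerr.delta_pos (le_of_lt hMa) hρ)) (Real.exp_pos s)

/-- `g` is strictly increasing. [folklore] -/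
theorem strictMono_tortoiseAux (hMa : IsSubextremal M a) : StrictMono (tortoiseAux M a) :=
  strictMono_of_deriv_pos fun s ↦ by
    rw [(hasDerivAt_tortoiseAux hMa s).deriv]; exact tortoiseAux_deriv_pos hMa s

/-- `g` is continuous. [folklore] -/
theorem continuous_tortoiseAux (hMa : IsSubextremal M a) : Continuous (tortoiseAux M a) :=
  continuous_iff_continuousAt.2 fun s ↦ (hasDerivAt_tortoiseAux hMa s).continuousAt

/-- `g(s) → +∞` as `s → +∞` (`t̄(r) ≥ r − 2Mr₋` for `r ≥ r₊ + 1`). [folklore] -/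
theorem tendsto_tortoiseAux_atTop (hMa : IsSubextremal M a) :
    Tendsto (tortoiseAux M a) atTop atTop := by
  have hlow : ∀ᶠ s in atTop, rPlus M a + Real.exp s - 2 * M * rMinus M a ≤ tortoiseAux M a s := by
    filter_upwards [eventually_ge_atTop (0 : ℝ)] with s hs
    have h1 : rPlus M a + 1 ≤ rPlus M a + Real.exp s := by
      linarith [Real.one_le_exp hs]
    have h := neg_le_starTime_sub_self hMa h1
    unfold tortoiseAux
    linarith
  refine tendsto_atTop_mono' atTop hlow ?_
  have h : Tendsto (fun s ↦ Real.exp s + (rPlus M a - 2 * M * rMinus M a)) atTop atTop :=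
    tendsto_atTop_add_const_right _ _ Real.tendsto_exp_atTop
  refine h.congr fun s ↦ ?_
  ring

/-- `g(s) → −∞` as `s → −∞` (`t̄(r₊ + eˢ) = (r₊ + eˢ) + A s − B log(r₊ + eˢ − r₋)` with
`A = 2Mr₊/(r₊ − r₋) > 0`, `B ≥ 0`). [folklore] -/
theorem tendsto_tortoiseAux_atBot (hMa : IsSubextremal M a) :
    Tendsto (tortoiseAux M a) atBot atBot := by
  have hM := hMa.pos
  have hpm : 0 < rPlus M a - rMinus M a := sub_pos.2 hMa.rMinus_lt_rPlus
  have hr : 0 < rPlus M a := hM.trans_le (M_le_rPlus M a)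
  set A : ℝ := 2 * M * rPlus M a / (rPlus M a - rMinus M a) with hA
  set B : ℝ := 2 * M * rMinus M a / (rPlus M a - rMinus M a) with hB
  have hA0 : 0 < A := by positivity
  have hB0 : 0 ≤ B := by
    have := hMa.rMinus_nonneg
    positivity
  -- upper bound for `s ≤ 0`: `g(s) ≤ (r₊ + 1) + A s − B log(r₊ − r₋)`
  have hup : ∀ᶠ s in atBot, tortoiseAux M a s ≤
      A * s + (rPlus M a + 1 - B * Real.log (rPlus M a - rMinus M a)) := by
    filter_upwards [eventually_le_atBot (0 : ℝ)] with s hs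
    have he : Real.exp s ≤ 1 := Real.exp_le_one_iff.2 hs
    have he0 : 0 < Real.exp s := Real.exp_pos s
    have hlog1 : Real.log (rPlus M a + Real.exp s - rPlus M a) = s := by
      rw [add_sub_cancel_left, Real.log_exp]
    have hlog2 : Real.log (rPlus M a - rMinus M a) ≤
        Real.log (rPlus M a + Real.exp s - rMinus M a) :=
      Real.log_le_log hpm (by linarith)
    have hexpr : tortoiseAux M a s = rPlus M a + Real.exp s + A * s -
        B * Real.log (rPlus M a + Real.exp s - rMinus M a) := by
      unfold tortoiseAux starTime
      rw [hlog1]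
    rw [hexpr]
    nlinarith [mul_le_mul_of_nonneg_left hlog2 hB0]
  refine tendsto_atBot_mono' atBot hup ?_
  exact tendsto_atBot_add_const_right _ _ (Tendsto.const_mul_atBot hA0 tendsto_id)

/-- `g` is a bijection of `ℝ`. [folklore] -/
theorem surjective_tortoiseAux (hMa : IsSubextremal M a) : Function.Surjective (tortoiseAux M a) :=
  (continuous_tortoiseAux hMa).surjective (tendsto_tortoiseAux_atTop hMa)
    (tendsto_tortoiseAux_atBot hMa)

/-- The order isomorphism `g : ℝ ≃o ℝ`. [folklore] -/
def tortoiseAuxIso (hMa : IsSubextremal M a) : ℝ ≃o ℝ :=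
  (strictMono_tortoiseAux hMa).orderIsoOfSurjective _ (surjective_tortoiseAux hMa)

/-- **The tortoise radius function obtained by inverting `t̄`**: `R(x) = r₊ + exp(g⁻¹(x))`, i.e.
the unique `r > r₊` with `t̄(r) = x`. [cite: DafermosRodnianskiShlapentokhrothman2014, §2.1.2] -/
def tortoiseRadius (hMa : IsSubextremal M a) (x : ℝ) : ℝ :=
  rPlus M a + Real.exp ((tortoiseAuxIso hMa).symm x)

/-- `t̄(R(x)) = x`: `R` inverts the tortoise primitive `t̄ = starTime M a` (`= r*` up to an additive
constant). [cite: DafermosRodnianskiShlapentokhrothman2014, §2.1.2] -/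
theorem starTime_tortoiseRadius (hMa : IsSubextremal M a) (x : ℝ) :
    starTime M a (tortoiseRadius hMa x) = x := by
  have h := (tortoiseAuxIso hMa).apply_symm_apply x
  have h' : tortoiseAux M a ((tortoiseAuxIso hMa).symm x) = x := by
    rwa [tortoiseAuxIso, StrictMono.coe_orderIsoOfSurjective] at h
  exact h'

/-- **Existence of tortoise radius functions**: `tortoiseRadius` is one (for `|a| < M`).
[cite: DafermosRodnianskiShlapentokhrothman2014, §2.1.2] -/
theorem isTortoiseRadius_tortoiseRadius (hMa : IsSubextremal M a) :
    IsTortoiseRadius M a (tortoiseRadius hMa) := by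
  set e := tortoiseAuxIso hMa with he
  have hcoe : ∀ s, e s = tortoiseAux M a s := fun s ↦ by
    rw [he, tortoiseAuxIso, StrictMono.coe_orderIsoOfSurjective]
  have hsymm_cont : Continuous e.symm := e.symm.continuous
  -- derivative of the inverse
  have hderiv_symm : ∀ x, HasDerivAt e.symm
      (((rPlus M a + Real.exp (e.symm x)) ^ 2 + a ^ 2) / delta M a (rPlus M a + Real.exp (e.symm x)) *
        Real.exp (e.symm x))⁻¹ x := fun x ↦ by
    have hf := hasDerivAt_tortoiseAux hMa (e.symm x)
    refine hf.of_local_left_inverse hsymm_cont.continuousAt (tortoiseAux_deriv_pos hMa _).ne' ?_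
    exact Eventually.of_forall fun y ↦ (hcoe (e.symm y)).symm.trans (e.apply_symm_apply y)
  refine ⟨fun x ↦ ?_, fun x ↦ ?_, ?_, ?_⟩
  · -- `dR/dx = exp(g⁻¹ x) · (g⁻¹)'(x) = Δ/(R² + a²)`
    have h := ((hderiv_symm x).exp).const_add (rPlus M a)
    refine h.congr_deriv ?_
    have hρ : rPlus M a < rPlus M a + Real.exp (e.symm x) := lt_add_of_pos_right _ (Real.exp_pos _)
    have hΔ : 0 < delta M a (rPlus M a + Real.exp (e.symm x)) := Kerr.delta_pos (le_of_lt hMa) hρ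
    have h0 : 0 < rPlus M a + Real.exp (e.symm x) :=
      (hMa.pos.trans_le (M_le_rPlus M a)).trans hρ
    have hD : 0 < (rPlus M a + Real.exp (e.symm x)) ^ 2 + a ^ 2 := by positivity
    have hex : 0 < Real.exp (e.symm x) := Real.exp_pos _
    show Real.exp (e.symm x) *
        (((rPlus M a + Real.exp (e.symm x)) ^ 2 + a ^ 2) /
            delta M a (rPlus M a + Real.exp (e.symm x)) * Real.exp (e.symm x))⁻¹ =
      delta M a (tortoiseRadius hMa x) / (tortoiseRadius hMa x ^ 2 + a ^ 2)
    unfold tortoiseRadius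
    rw [← he]
    field_simp
  · exact lt_add_of_pos_right _ (Real.exp_pos _)
  · -- `R → r₊ + 0` at `−∞`
    have h := (Real.tendsto_exp_atBot.comp e.symm.tendsto_atBot).const_add (rPlus M a)
    rw [add_zero] at h
    exact h
  · -- `R → ∞` at `+∞`
    exact tendsto_atTop_add_const_left _ _ (Real.tendsto_exp_atTop.comp e.symm.tendsto_atTop)

/-- **Tortoise radius functions exist** on every sub-extremal Kerr exterior. DRSR arXiv:1402.7034,
§2.1.2 ("`r` is a smoothly invertible function of `r*`", §5.2.3). [cite: DafermosRodnianskiShlapentokhrothman2014, §2.1.2] -/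
theorem exists_isTortoiseRadius (hMa : IsSubextremal M a) : ∃ R, IsTortoiseRadius M a R :=
  ⟨tortoiseRadius hMa, isTortoiseRadius_tortoiseRadius hMa⟩

end Existence

end Kerr

end Literature.Geometry.Lorentzian

end
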